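import Summits.Ventures.HodgeRepro2.A2HodgeTypeModel
import Summits.Ventures.HodgeRepro2.A2LamAdjoint
import Summits.Ventures.HodgeRepro2.A2IntegralDegree

/-!
# A2HodgeBigrading — the bigrading of the twelve-plane model is a direct-sum decomposition
refining the degree grading, with the Hodge numbers of an `n`-dimensional abelian variety

Tier-4 annex of sub-claim A2 (seat p6, cell pub-hodge-repro2); §8(d): uses an L-value-free
non-vanishing device: NO.

The model of A2 (p5's `WeilPlanes` … `WeilVector`, p6's `A2ModelDuality` …) is the exterior
algebra `A ι = ⋀ V ι` on the `2|ι|` generators `a_p = gen (p, false)`, `b_p = gen (p, true)`;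
`A2HodgeTypeModel.hgrading a b` is the span of the monomials with `a` generators of the first
kind and `b` of the second kind (`a_p ↦ (1,0)`, `b_p ↦ (0,1)`).  This file records what the
prose of A2 calls «the Hodge decomposition of `H^*(B, ℂ) = ⋀^* H^1`» AT THE MODEL LEVEL:

* `hgrading_le_grading`: `hgrading a b ⊆ ⋀^{a+b}`;
* `hgrading_eq_span`: `hgrading a b` is spanned by the basis monomials `aBasis s` (row 90) of
  bidegree `(a, b)`;
* `isInternal_hgrading`: the family `(a, b) ↦ hgrading a b` is an internal direct-sum
  decomposition of the model (`DirectSum.IsInternal`);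
* `grading_eq_iSup_hgrading`: `⋀^k = ⨆_{a+b=k} hgrading a b` — the bigrading refines the
  degree grading;
* `mem_hgrading_iff`: membership read on the coordinates of row 90's basis.

The counting (`dim hgrading a b = C(n, a) · C(n, b)`, the Hodge numbers) is the sequel file
`A2HodgeNumbers.lean`.

What stays prose: the identification of this bigrading with the Hodge decomposition of the
cohomology of the abelian variety `B` itself (A0.3 (ii)–(iii)); the model only has the algebra.
-/

namespace Summit.Ventures.HodgeRepro2.A2HodgeBigrading

open WeilPlanes WeilIntegral WeilCoproduct WeilDetect A2ModelDuality A2HodgeTypeModel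

variable {ι : Type*} [DecidableEq ι] [Fintype ι]

omit [Fintype ι] in
/-- A wedge monomial of `k` generators lies in `⋀^k`. -/
theorem mono_mem_grading (l : List (Gen ι)) : mono l ∈ grading ι l.length := by
  induction l with
  | nil =>
    show (1 : A ι) ∈ (LinearMap.range (ExteriorAlgebra.ι ℂ : V ι →ₗ[ℂ] A ι)) ^ 0
    rw [pow_zero]
    exact Submodule.mem_one.mpr ⟨1, map_one _⟩
  | cons j l ih =>
    have h1 : gen j ∈ grading ι 1 := ι_mem_one _
    have h2 := SetLike.mul_mem_graded h1 ih
    rw [add_comm] at h2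
    exact h2

omit [DecidableEq ι] [Fintype ι] in
/-- The length of a generator list is the sum of its two counts `cA l + cB l`. -/
theorem length_eq_cA_add_cB (l : List (Gen ι)) : l.length = cA l + cB l := by
  induction l with
  | nil => rfl
  | cons j l ih =>
    obtain ⟨p, b⟩ := j
    cases b <;> simp [cA, cB] at ih ⊢ <;> omega

omit [Fintype ι] in
/-- The bigrading refines the degree grading: `hgrading a b ⊆ ⋀^{a+b}`. -/
theorem hgrading_le_grading (a b : ℕ) : hgrading a b ≤ grading ι (a + b) := by
  refine Submodule.span_le.mpr ?_
  rintro x ⟨l, ha, hb, rfl⟩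
  have := mono_mem_grading l
  rwa [length_eq_cA_add_cB, ha, hb] at this

/-- The bidegree of a basis index set `s` of row 90: the numbers of generators of the first and
of the second kind in its generator list. -/
noncomputable def bideg (s : Finset (Fin (Fintype.card (Gen ι)))) : ℕ × ℕ :=
  (cA (genListOf s), cB (genListOf s))

/-- The basis monomial `aBasis s` has bidegree `bideg s`. -/
theorem aBasis_mem_hgrading (s : Finset (Fin (Fintype.card (Gen ι)))) :
    aBasis s ∈ hgrading (bideg s).1 (bideg s).2 := by
  rw [aBasis_apply]
  exact mono_mem_hgrading _

omit [DecidableEq ι] in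
/-- The two components of the bidegree add up to the degree `|s|`. -/
theorem bideg_fst_add_snd (s : Finset (Fin (Fintype.card (Gen ι)))) :
    (bideg s).1 + (bideg s).2 = s.card := by
  rw [← length_genListOf]
  exact (length_eq_cA_add_cB _).symm

/-- The generator list of the index set `(l.map enum).toFinset` is a permutation of the
duplicate-free list `l`. -/
theorem perm_genListOf_toFinset_map {l : List (Gen ι)} (hl : l.Nodup) :
    (genListOf (l.map enum).toFinset).Perm l := by
  refine List.perm_of_nodup_nodup_toFinset_eq (A2LamAdjoint.genListOf_nodup _) hl ?_
  ext j
  simp [mem_genListOf]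

/-- Every duplicate-free monomial is `±` a basis monomial of row 90: `mono l = ε • aBasis s` with
`s = (l.map enum).toFinset`. -/
theorem exists_sign_mono_eq_aBasis {l : List (Gen ι)} (hl : l.Nodup) :
    ∃ ε : ℂ, (ε = 1 ∨ ε = -1) ∧ mono l = ε • aBasis (l.map enum).toFinset := by
  rw [aBasis_apply]
  exact WeilVector.mono_perm (perm_genListOf_toFinset_map hl).symm

/-- The bidegree of the index set of a duplicate-free list is `(cA l, cB l)`. -/
theorem bideg_toFinset_map {l : List (Gen ι)} (hl : l.Nodup) :
    bideg (l.map enum).toFinset = (cA l, cB l) := by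
  have hp := perm_genListOf_toFinset_map hl
  exact Prod.ext (hp.countP_eq _) (hp.countP_eq _)

/-- `hgrading a b` is spanned by the basis monomials of bidegree `(a, b)`. -/
theorem hgrading_eq_span (a b : ℕ) :
    (hgrading a b : Submodule ℂ (A ι)) = Submodule.span ℂ (aBasis '' {s | bideg s = (a, b)}) := by
  apply le_antisymm
  · refine Submodule.span_le.mpr ?_
    rintro x ⟨l, ha, hb, rfl⟩
    by_cases hl : l.Nodup
    · obtain ⟨ε, -, hε⟩ := exists_sign_mono_eq_aBasis hl
      rw [hε]
      refine Submodule.smul_mem _ _ (Submodule.subset_span ⟨_, ?_, rfl⟩)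
      rw [Set.mem_setOf_eq, bideg_toFinset_map hl, ha, hb]
    · rw [mono_eq_zero_of_not_nodup hl]
      exact Submodule.zero_mem _
  · refine Submodule.span_le.mpr ?_
    rintro x ⟨s, hs, rfl⟩
    rw [Set.mem_setOf_eq] at hs
    have := aBasis_mem_hgrading s
    rw [hs] at this
    exact this

/-- Membership in `hgrading a b` read on the coordinates: every basis index set carrying a
non-zero coordinate has bidegree `(a, b)`. -/
theorem mem_hgrading_iff (a b : ℕ) (x : A ι) :
    x ∈ hgrading a b ↔ ∀ s, aBasis.repr x s ≠ 0 → bideg s = (a, b) := by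
  rw [hgrading_eq_span, Module.Basis.mem_span_image]
  simp only [Set.subset_def, Finset.mem_coe, Finsupp.mem_support_iff, Set.mem_setOf_eq]

/-- The subspaces `hgrading a b`, `(a, b) ∈ ℕ × ℕ`, are independent. -/
theorem iSupIndep_hgrading :
    iSupIndep (fun ab : ℕ × ℕ => (hgrading ab.1 ab.2 : Submodule ℂ (A ι))) := by
  rw [iSupIndep_def]
  intro ab
  rw [Submodule.disjoint_def]
  intro x hx hx'
  have h1 : ∀ s, aBasis.repr x s ≠ 0 → bideg s = ab := by
    have := (mem_hgrading_iff ab.1 ab.2 x).mp hx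
    simpa using this
  have hle : (⨆ j, ⨆ (_ : j ≠ ab), (hgrading j.1 j.2 : Submodule ℂ (A ι))) ≤
      Submodule.span ℂ (aBasis '' {s | bideg s ≠ ab}) := by
    refine iSup₂_le fun j hj => ?_
    rw [hgrading_eq_span]
    refine Submodule.span_mono (Set.image_mono fun s hs => ?_)
    rw [Set.mem_setOf_eq] at hs ⊢
    rw [hs]
    exact hj
  have h2 := hle hx'
  rw [Module.Basis.mem_span_image] at h2
  have h3 : aBasis.repr x = 0 := by
    ext s
    by_contra hs
    exact (h2 (Finsupp.mem_support_iff.mpr hs)) (h1 s hs)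
  exact aBasis.repr.map_eq_zero_iff.mp h3

/-- The subspaces `hgrading a b` span the model. -/
theorem iSup_hgrading_eq_top :
    (⨆ ab : ℕ × ℕ, (hgrading ab.1 ab.2 : Submodule ℂ (A ι))) = ⊤ := by
  rw [eq_top_iff, ← (aBasis (ι := ι)).span_eq, Submodule.span_le]
  rintro x ⟨s, rfl⟩
  exact le_iSup (fun ab : ℕ × ℕ => (hgrading ab.1 ab.2 : Submodule ℂ (A ι))) (bideg s)
    (aBasis_mem_hgrading s)

/-- THE HODGE DECOMPOSITION OF THE MODEL: the bigrading `(a, b) ↦ hgrading a b` is an internal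
direct-sum decomposition of `A ι = ⋀ V ι`. -/
theorem isInternal_hgrading :
    DirectSum.IsInternal (fun ab : ℕ × ℕ => (hgrading ab.1 ab.2 : Submodule ℂ (A ι))) :=
  DirectSum.isInternal_submodule_of_iSupIndep_of_iSup_eq_top iSupIndep_hgrading
    iSup_hgrading_eq_top

/-- `⋀^k` is spanned by the basis monomials of degree `k` (row 88's `exteriorPower_le_span_mono`
together with `exists_sign_mono_eq_aBasis`). -/
theorem grading_eq_span_aBasis (k : ℕ) :
    grading ι k = Submodule.span ℂ (aBasis '' {s | s.card = k}) := by
  apply le_antisymm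
  · refine le_trans (A2IntegralDegree.exteriorPower_le_span_mono k) (Submodule.span_le.mpr ?_)
    rintro x ⟨l, hl, rfl⟩
    by_cases hn : l.Nodup
    · obtain ⟨ε, -, hε⟩ := exists_sign_mono_eq_aBasis hn
      rw [hε]
      refine Submodule.smul_mem _ _ (Submodule.subset_span ⟨_, ?_, rfl⟩)
      rw [Set.mem_setOf_eq, List.toFinset_card_of_nodup (hn.map enum.injective), List.length_map,
        hl]
    · rw [mono_eq_zero_of_not_nodup hn]
      exact Submodule.zero_mem _
  · refine Submodule.span_le.mpr ?_
    rintro x ⟨s, hs, rfl⟩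
    rw [Set.mem_setOf_eq] at hs
    rw [← hs]
    exact A2PontryaginDegree.aBasis_mem_grading s

/-- THE BIGRADING REFINES THE DEGREE GRADING: `⋀^k = ⨆_{a + b = k} hgrading a b`. -/
theorem grading_eq_iSup_hgrading (k : ℕ) :
    grading ι k = ⨆ (ab : ℕ × ℕ) (_ : ab.1 + ab.2 = k), (hgrading ab.1 ab.2 : Submodule ℂ (A ι)) := by
  apply le_antisymm
  · rw [grading_eq_span_aBasis, Submodule.span_le]
    rintro x ⟨s, hs, rfl⟩
    rw [Set.mem_setOf_eq] at hs
    exact le_iSup₂ (f := fun (ab : ℕ × ℕ) (_ : ab.1 + ab.2 = k) =>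
      (hgrading ab.1 ab.2 : Submodule ℂ (A ι))) (bideg s) (by rw [bideg_fst_add_snd, hs])
      (aBasis_mem_hgrading s)
  · refine iSup₂_le fun ab hab => ?_
    rw [← hab]
    exact hgrading_le_grading ab.1 ab.2

end Summit.Ventures.HodgeRepro2.A2HodgeBigrading
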